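/-
[OURS · L1 W4.5(b) · EL♮(3)] SPECIMEN-Q DOWNSTAIRS — part G1 (the chart of Γ over the ambient chart).
[claim: Hironaka2017, status: under-review]
-/
import Summits.ResolutionOfSingularities.ResolutionOfSingularities.Theorems.EquisingularLiftEquisingularLiftNatSpecimenQuarticTcDeltaChartStep
import Summits.ResolutionOfSingularities.ResolutionOfSingularities.Theorems.EquisingularLiftEquisingularLiftNatSpecimenQuarticTcDeltaTransport
import Literature.AlgebraicGeometry.Resolution.IdealSheafDescent

/-!
# [OURS · L1 W4.5(b) · EL♮(3)] SPECIMEN-Q DOWNSTAIRS, part G1 — THE CHART `Spec D₀ → Γ = V(closure T)_red` OVER THE AMBIENT CHART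
# (crux `EquisingularLiftNatThree` = stmt-ResolutionOfSingularities-20148, line `sections3`; res-L1-w45b-lead-2 CUT 2026-08-27T08:41:07Z
# «SPECIMEN-Q DOWNSTAIRS» to res-D-pv-034 AS res-L1-s36-pv-3; helper, closes nothing)

HONEST FRAMING. OURS (cell `res-hironaka`, chain w45b, slot W4.5(b)); NOT a statement of any manuscript; AI-written, weaker than
expert review.

For an open-immersion chart `w : Spec k[X] → Y` with `𝓘_T · 𝒪 = (z² + x⁴ + y⁴)~` (`T` closed): the affine piece of the reduced
subscheme `Γ = V(closure T)_red` over `U = w(Spec k[X])` is `Spec (Γ(Y,U)/𝓘(U)) ≅ Spec D₀`, `D₀ = k[X]/(f)` (Mathlib's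
`subschemeCover`); this file packages that chart `gammaChart : Spec D₀ → Γ` (open immersion, range `Γι⁻¹ U`), shows it sees the point
`x₀` of `Γ` over `w(o)` exactly at `pt = 𝔪̄₀` (`preimage_gammaChart_singleton`), and that the trace `𝓘_{w(o)} · 𝒪_Γ` pulls back to
`𝔪̄₀~` (`comap_gammaChart_trace_singleton`) — the input form of `…TcDeltaLocalTwoStep.isRegular_twoStep`.

References: Stacks 01R8, 080E; Hartshorne II Ex. 3.2.6 (via the cited tree files).
-/

set_option linter.dupNamespace false -- mandated namespace `Summit.<Summit>.<Problem>` of this single-conjunct summit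

noncomputable section

open CategoryTheory CategoryTheory.Limits AlgebraicGeometry TopologicalSpace
open MvPolynomial
open AlgebraicGeometry.Scheme.IdealSheafData
open Literature.AlgebraicGeometry.Resolution
open Summit.ResolutionOfSingularities.ResolutionOfSingularities.Theorems.EquisingularLift

namespace Summit.ResolutionOfSingularities.ResolutionOfSingularities.Cruxes.EquisingularLiftNat.Sections

namespace SpecimenQuarticTcDelta

section GammaChart

variable {k : Type} [Field k]
variable {Y : Scheme.{0}} (w : Spec (CommRingCat.of (MvPolynomial (Fin 3) k)) ⟶ Y) [IsOpenImmersion w]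
variable {T : Set Y} (hTc : IsClosed T)
variable (hwT : (vanishingIdeal (⟨T, hTc⟩ : Closeds Y)).comap w =
    ofIdealTop ((Ideal.span {(X 2 ^ 2 + X 0 ^ 4 + X 1 ^ 4 : MvPolynomial (Fin 3) k)}).map
      (Scheme.ΓSpecIso (CommRingCat.of (MvPolynomial (Fin 3) k))).inv.hom))

omit [IsOpenImmersion w] in
/-- `𝓘_{closure T}` also pulls back to `(f)~`. [folklore] -/
theorem comap_vanishingIdeal_closure_eq (hwT : (vanishingIdeal (⟨T, hTc⟩ : Closeds Y)).comap w =
    ofIdealTop ((Ideal.span {(X 2 ^ 2 + X 0 ^ 4 + X 1 ^ 4 : MvPolynomial (Fin 3) k)}).map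
      (Scheme.ΓSpecIso (CommRingCat.of (MvPolynomial (Fin 3) k))).inv.hom)) :
    (vanishingIdeal (⟨closure T, isClosed_closure⟩ : Closeds Y)).comap w =
    ofIdealTop ((Ideal.span {(X 2 ^ 2 + X 0 ^ 4 + X 1 ^ 4 : MvPolynomial (Fin 3) k)}).map
      (Scheme.ΓSpecIso (CommRingCat.of (MvPolynomial (Fin 3) k))).inv.hom) := by
  have hcl : (⟨closure T, isClosed_closure⟩ : Closeds Y) = ⟨T, hTc⟩ := Closeds.ext hTc.closure_eq
  rw [hcl, hwT]

/-- **`Γ(Y, U)/𝓘_{closure T}(U) ≅ D₀ = k[X]/(f)`** on the chart `U = w(Spec k[X])`. [folklore] -/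
def sectionsQuotEquiv (hwT : (vanishingIdeal (⟨T, hTc⟩ : Closeds Y)).comap w =
    ofIdealTop ((Ideal.span {(X 2 ^ 2 + X 0 ^ 4 + X 1 ^ 4 : MvPolynomial (Fin 3) k)}).map
      (Scheme.ΓSpecIso (CommRingCat.of (MvPolynomial (Fin 3) k))).inv.hom)) :
    (Γ(Y, (chartOpen w : Y.Opens)) ⧸ (vanishingIdeal (⟨closure T, isClosed_closure⟩ : Closeds Y)).ideal (chartOpen w)) ≃+* D₀ k :=
  Ideal.quotientEquiv _ _ (chartRingEquiv w)
    (map_ideal_chartOpen_eq w _ _ (comap_vanishingIdeal_closure_eq w hTc hwT)).symm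

/-- `Spec D₀ ≅ Spec (Γ(Y,U)/𝓘(U))`. [folklore] -/
def specIsoD (hwT : (vanishingIdeal (⟨T, hTc⟩ : Closeds Y)).comap w =
    ofIdealTop ((Ideal.span {(X 2 ^ 2 + X 0 ^ 4 + X 1 ^ 4 : MvPolynomial (Fin 3) k)}).map
      (Scheme.ΓSpecIso (CommRingCat.of (MvPolynomial (Fin 3) k))).inv.hom)) :
    Spec (CommRingCat.of (D₀ k)) ≅ Spec (CommRingCat.of (Γ(Y, (chartOpen w : Y.Opens)) ⧸
      (vanishingIdeal (⟨closure T, isClosed_closure⟩ : Closeds Y)).ideal (chartOpen w))) :=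
  Scheme.Spec.mapIso (sectionsQuotEquiv w hTc hwT).toCommRingCatIso.op

/-- **The chart of `Γ = V(closure T)_red` over `w(Spec k[X])`**: `Spec D₀ ≅ Spec (Γ(Y,U)/𝓘(U)) → Γ`. [cite: StacksProject, Tag 01R8] -/
def gammaChart (hwT : (vanishingIdeal (⟨T, hTc⟩ : Closeds Y)).comap w =
    ofIdealTop ((Ideal.span {(X 2 ^ 2 + X 0 ^ 4 + X 1 ^ 4 : MvPolynomial (Fin 3) k)}).map
      (Scheme.ΓSpecIso (CommRingCat.of (MvPolynomial (Fin 3) k))).inv.hom)) :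
    Spec (CommRingCat.of (D₀ k)) ⟶ (vanishingIdeal (⟨closure T, isClosed_closure⟩ : Closeds Y)).subscheme :=
  (specIsoD w hTc hwT).hom ≫ (vanishingIdeal (⟨closure T, isClosed_closure⟩ : Closeds Y)).subschemeCover.f (chartOpen w)

/-- The chart of `Γ` is an open immersion. [folklore] -/
instance isOpenImmersion_gammaChart (hwT : (vanishingIdeal (⟨T, hTc⟩ : Closeds Y)).comap w =
    ofIdealTop ((Ideal.span {(X 2 ^ 2 + X 0 ^ 4 + X 1 ^ 4 : MvPolynomial (Fin 3) k)}).map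
      (Scheme.ΓSpecIso (CommRingCat.of (MvPolynomial (Fin 3) k))).inv.hom)) :
    IsOpenImmersion (gammaChart w hTc hwT) :=
  @IsOpenImmersion.comp _ _ _ (specIsoD w hTc hwT).hom _ inferInstance
    ((vanishingIdeal (⟨closure T, isClosed_closure⟩ : Closeds Y)).subschemeCover.map_prop (chartOpen w))

/-- `gammaChart ≫ Γι = Spec(quotient ∘ iso) ≫ U.fromSpec`. [folklore] -/
theorem gammaChart_comp_subschemeι :
    gammaChart w hTc hwT ≫ (vanishingIdeal (⟨closure T, isClosed_closure⟩ : Closeds Y)).subschemeι =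
      (specIsoD w hTc hwT).hom ≫ Spec.map (CommRingCat.ofHom (Ideal.Quotient.mk _)) ≫ (chartOpen w).2.fromSpec := by
  rw [gammaChart, Category.assoc]
  erw [subschemeCover_map_subschemeι, glueDataObjι_ι]

/-- The range of the chart of `Γ` is `Γι⁻¹(w(Spec k[X]))`. [folklore] -/
theorem range_gammaChart :
    Set.range (gammaChart w hTc hwT) =
      (vanishingIdeal (⟨closure T, isClosed_closure⟩ : Closeds Y)).subschemeι ⁻¹' Set.range w := by
  have hsurj : Function.Surjective (specIsoD w hTc hwT).hom := (Scheme.homeoOfIso (specIsoD w hTc hwT)).surjective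
  have h1 : Set.range (gammaChart w hTc hwT) =
      Set.range ((vanishingIdeal (⟨closure T, isClosed_closure⟩ : Closeds Y)).subschemeCover.f (chartOpen w)) := by
    rw [gammaChart]
    change Set.range (fun q => (vanishingIdeal (⟨closure T, isClosed_closure⟩ : Closeds Y)).subschemeCover.f (chartOpen w)
      ((specIsoD w hTc hwT).hom q)) = _
    exact hsurj.range_comp _
  rw [h1, ← Scheme.Hom.coe_opensRange, opensRange_subschemeCover_map]
  change (vanishingIdeal (⟨closure T, isClosed_closure⟩ : Closeds Y)).subschemeι ⁻¹' ((chartOpen w : Y.Opens) : Set Y) = _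
  congr 1
  change ((w ''ᵁ ⊤ : Y.Opens) : Set Y) = Set.range w
  rw [Scheme.Hom.image_top_eq_opensRange]
  rfl

/-- A point of `Γ` over the chart is in the range of `gammaChart`. [folklore] -/
theorem mem_range_gammaChart {x : (vanishingIdeal (⟨closure T, isClosed_closure⟩ : Closeds Y)).subscheme}
    (hx : (vanishingIdeal (⟨closure T, isClosed_closure⟩ : Closeds Y)).subschemeι x ∈ Set.range w) :
    x ∈ Set.range (gammaChart w hTc hwT) := by
  rw [range_gammaChart]; exact hx


omit [IsOpenImmersion w] in
/-- A point `x₀` of `Γ` over `w(o)`: `{x₀} = Γι⁻¹{w(o)}` is closed. [folklore] -/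
theorem isClosed_singleton_of_subschemeι_eq (hc : IsClosed ({w (o k)} : Set Y))
    {x₀ : (vanishingIdeal (⟨closure T, isClosed_closure⟩ : Closeds Y)).subscheme}
    (hx₀ : (vanishingIdeal (⟨closure T, isClosed_closure⟩ : Closeds Y)).subschemeι x₀ = w (o k)) :
    IsClosed ({x₀} : Set (vanishingIdeal (⟨closure T, isClosed_closure⟩ : Closeds Y)).subscheme) := by
  have h : ({x₀} : Set (vanishingIdeal (⟨closure T, isClosed_closure⟩ : Closeds Y)).subscheme) =
      (vanishingIdeal (⟨closure T, isClosed_closure⟩ : Closeds Y)).subschemeι ⁻¹' {w (o k)} := by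
    ext x
    simp only [Set.mem_singleton_iff, Set.mem_preimage]
    rw [← hx₀]
    exact ((vanishingIdeal (⟨closure T, isClosed_closure⟩ : Closeds Y)).subschemeι.isClosedEmbedding.injective.eq_iff).symm
  rw [h]
  exact hc.preimage (Scheme.Hom.continuous _)

omit [IsOpenImmersion w] in
/-- The trace of `𝓘_{w(o)}` on `Γ` is the ideal of the point `x₀` over it. [folklore] -/
theorem comap_subschemeι_vanishingIdeal_singleton (hc : IsClosed ({w (o k)} : Set Y))
    {x₀ : (vanishingIdeal (⟨closure T, isClosed_closure⟩ : Closeds Y)).subscheme}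
    (hx₀ : (vanishingIdeal (⟨closure T, isClosed_closure⟩ : Closeds Y)).subschemeι x₀ = w (o k)) :
    (vanishingIdeal (⟨{w (o k)}, hc⟩ : Closeds Y)).comap (vanishingIdeal (⟨closure T, isClosed_closure⟩ : Closeds Y)).subschemeι =
      vanishingIdeal (⟨{x₀}, isClosed_singleton_of_subschemeι_eq w hc hx₀⟩ :
        Closeds (vanishingIdeal (⟨closure T, isClosed_closure⟩ : Closeds Y)).subscheme) := by
  have h := comap_vanishingIdeal_image_of_isClosedImmersion
    (vanishingIdeal (⟨closure T, isClosed_closure⟩ : Closeds Y)).subschemeι ⟨{x₀}, isClosed_singleton_of_subschemeι_eq w hc hx₀⟩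
  have hD : (⟨(vanishingIdeal (⟨closure T, isClosed_closure⟩ : Closeds Y)).subschemeι ''
      ((⟨{x₀}, isClosed_singleton_of_subschemeι_eq w hc hx₀⟩ :
        Closeds (vanishingIdeal (⟨closure T, isClosed_closure⟩ : Closeds Y)).subscheme) : Set _),
      (vanishingIdeal (⟨closure T, isClosed_closure⟩ : Closeds Y)).subschemeι.isClosedEmbedding.isClosedMap _
        (⟨{x₀}, isClosed_singleton_of_subschemeι_eq w hc hx₀⟩ : Closeds _).2⟩ : Closeds Y) = ⟨{w (o k)}, hc⟩ :=
    Closeds.ext (by change _ '' {x₀} = {w (o k)}; rw [Set.image_singleton, hx₀])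
  rw [hD] at h
  exact h

/-- `{pt} = V(𝔪̄₀)` in `Spec D₀`. [folklore] -/
theorem singleton_pt_eq_zeroLocus : ({pt k} : Set (Spec (CommRingCat.of (D₀ k)))) = PrimeSpectrum.zeroLocus (mbar k) := by
  ext q
  rw [Set.mem_singleton_iff]
  constructor
  · rintro rfl
    exact (PrimeSpectrum.mem_zeroLocus _ _).mpr le_rfl
  · intro hq
    have hle : mbar k ≤ q.asIdeal := (PrimeSpectrum.mem_zeroLocus _ _).mp hq
    apply PrimeSpectrum.ext
    exact ((isMaximal_mbar k).eq_of_le q.isPrime.ne_top hle).symm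

/-- `𝓘_{pt} = 𝔪̄₀~` on `Spec D₀`. [folklore] -/
theorem vanishingIdeal_singleton_pt :
    vanishingIdeal (⟨{pt k}, isClosed_pt k⟩ : Closeds (Spec (CommRingCat.of (D₀ k)))) =
      ofIdealTop ((mbar k).map (Scheme.ΓSpecIso (CommRingCat.of (D₀ k))).inv.hom) := by
  have h : (⟨{pt k}, isClosed_pt k⟩ : Closeds (Spec (CommRingCat.of (D₀ k)))) =
      ⟨PrimeSpectrum.zeroLocus (mbar k : Set (D₀ k)), PrimeSpectrum.isClosed_zeroLocus _⟩ :=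
    Closeds.ext (singleton_pt_eq_zeroLocus (k := k))
  rw [h]
  have h2 := vanishingIdeal_zeroLocus_Spec (CommRingCat.of (D₀ k)) (mbar k : Set (D₀ k))
  rw [Ideal.span_eq, (isMaximal_mbar k).isPrime.radical] at h2
  exact h2

/-- The ideal of `y₀ = w(o)` on `U`, pushed to `D₀`, is `𝔪̄₀`. [folklore] -/
theorem map_ideal_singleton_eq_mbar (hc : IsClosed ({w (o k)} : Set Y)) :
    ((vanishingIdeal (⟨{w (o k)}, hc⟩ : Closeds Y)).ideal (chartOpen w)).map
      ((sectionsQuotEquiv w hTc hwT).toRingHom.comp (Ideal.Quotient.mk _)) = mbar k := by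
  have h1 : (sectionsQuotEquiv w hTc hwT).toRingHom.comp
      (Ideal.Quotient.mk ((vanishingIdeal (⟨closure T, isClosed_closure⟩ : Closeds Y)).ideal (chartOpen w))) =
      (Ideal.Quotient.mk (Ideal.span {fQ k})).comp (chartRingEquiv w).toRingHom := by
    ext a
    rfl
  rw [h1, ← Ideal.map_map, hI_chart w hc (comap_vanishingIdeal_singleton_chart w hc)]

/-- **The chart of `Γ` sees the point `x₀` over `w(o)` only at `pt`**: `gammaChart⁻¹{x₀} = {pt}`. [folklore] -/
theorem preimage_gammaChart_singleton (hc : IsClosed ({w (o k)} : Set Y))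
    {x₀ : (vanishingIdeal (⟨closure T, isClosed_closure⟩ : Closeds Y)).subscheme}
    (hx₀ : (vanishingIdeal (⟨closure T, isClosed_closure⟩ : Closeds Y)).subschemeι x₀ = w (o k)) :
    gammaChart w hTc hwT ⁻¹' {x₀} = {pt k} := by
  ext q
  rw [Set.mem_preimage, Set.mem_singleton_iff, Set.mem_singleton_iff]
  have hinj := (vanishingIdeal (⟨closure T, isClosed_closure⟩ : Closeds Y)).subschemeι.isClosedEmbedding.injective
  rw [← hinj.eq_iff, hx₀, ← Scheme.Hom.comp_apply, gammaChart_comp_subschemeι, Scheme.Hom.comp_apply, Scheme.Hom.comp_apply,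
    fromSpec_apply_eq_iff hc]
  change (vanishingIdeal (⟨{w (o k)}, hc⟩ : Closeds Y)).ideal (chartOpen w) ≤
    (q.asIdeal.comap (sectionsQuotEquiv w hTc hwT).toRingHom).comap (Ideal.Quotient.mk _) ↔ _
  rw [Ideal.comap_comap, ← Ideal.map_le_iff_le_comap, map_ideal_singleton_eq_mbar w hTc hwT hc]
  constructor
  · intro hle
    apply PrimeSpectrum.ext
    exact ((isMaximal_mbar k).eq_of_le q.isPrime.ne_top hle).symm
  · rintro rfl
    exact le_rfl

/-- **The trace of `𝓘_{w(o)}` on `Γ`, pulled back to `Spec D₀`, is `𝔪̄₀~`.** [folklore] -/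
theorem comap_gammaChart_trace_singleton (hc : IsClosed ({w (o k)} : Set Y))
    {x₀ : (vanishingIdeal (⟨closure T, isClosed_closure⟩ : Closeds Y)).subscheme}
    (hx₀ : (vanishingIdeal (⟨closure T, isClosed_closure⟩ : Closeds Y)).subschemeι x₀ = w (o k)) :
    ((vanishingIdeal (⟨{w (o k)}, hc⟩ : Closeds Y)).comap
        (vanishingIdeal (⟨closure T, isClosed_closure⟩ : Closeds Y)).subschemeι).comap (gammaChart w hTc hwT) =
      ofIdealTop ((mbar k).map (Scheme.ΓSpecIso (CommRingCat.of (D₀ k))).inv.hom) := by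
  rw [comap_subschemeι_vanishingIdeal_singleton w hc hx₀, comap_vanishingIdeal_of_isOpenImmersion]
  have h : (Closeds.preimage (⟨{x₀}, isClosed_singleton_of_subschemeι_eq w hc hx₀⟩ :
      Closeds (vanishingIdeal (⟨closure T, isClosed_closure⟩ : Closeds Y)).subscheme) (gammaChart w hTc hwT).continuous) =
      ⟨{pt k}, isClosed_pt k⟩ := Closeds.ext (preimage_gammaChart_singleton w hTc hwT hc hx₀)
  rw [h, vanishingIdeal_singleton_pt (k := k)]

end GammaChart

end SpecimenQuarticTcDelta

end Summit.ResolutionOfSingularities.ResolutionOfSingularities.Cruxes.EquisingularLiftNat.Sections
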